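import Summits.CriticalPhenomena.PercolationContinuityZ3.Theses.PercTorusSliceFilling

/-!
# Route `PercTorusSliceFilling` — the assembly (item `stmt-CriticalPhenomena-5419`)

Settles the route decl
`Summit.CriticalPhenomena.PercolationContinuityZ3.Theses.PercTorusSliceFilling.Assembly`:

  `SliceFillingUpperBound → TorusNonProliferation → NoCriticalTorusGiant → PercolationContinuityZ3`.

Elementary probability on the finite configuration space of the torus `T_n = (ℤ/nℤ)³`
(every event is measurable, every function integrable). Write `P = P_{T_n, p_c}`, `θ = θ_{ℤ³}(p_c)`,
`A_x = {C(x) slice-filling}`, `N = #{slice-filling clusters}`, `V = #{x : C(x) slice-filling}`.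
Fix `δ > 0`; `TorusNonProliferation` gives `M` with `P(N ≥ M) ≤ δ` (`n ≥ 3`); put `K = M + 1`,
`ε = δ / K`. Off the bad event `Bad = {N ≥ K} ∪ {∃ x, |C(x)| ≥ ε n³}` every slice-filling vertex lies
in one of `< K` slice-filling clusters, each of size `< ε n³`, so `V ≤ K ε n³ = δ n³`; on `Bad`,
`V ≤ n³`. Hence `Σ_x P(A_x) = E V ≤ δ n³ + n³ P(Bad) ≤ δ n³ + n³ (δ + P(ε-giant))`, while
`SliceFillingUpperBound` gives `n³ θ ≤ Σ_x P(A_x)`. So `θ ≤ 2δ + P_{T_n,p_c}(ε-giant) → 2δ`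
(`NoCriticalTorusGiant`); `δ ↓ 0` and `θ ≥ 0` give `θ(p_c) = 0`, i.e. `PercolationContinuityZ3`.
-/

namespace Summit.CriticalPhenomena.PercolationContinuityZ3.Theorems

open MeasureTheory Filter Topology
open Literature.Probability.Percolation Literature.Probability.LatticeModels
open Summit.CriticalPhenomena.PercolationContinuityZ3.Theses.PercTorusSliceFilling

namespace PercTorusSliceFillingAssembly

/-- **Double counting.** On a probability space, for finitely many events `A x` and a bad event
`Bad` off which at most `c` of the `A x` occur simultaneously,
`Σ_x P(A x) ≤ c + #V · P(Bad)` (linearity of expectation for `V = Σ_x 1_{A x} ≤ c + #V · 1_{Bad}`).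
[folklore] -/
theorem sum_measureReal_le {Ω V : Type*} [MeasurableSpace Ω] [Fintype V]
    (P : Measure Ω) [IsProbabilityMeasure P] (A : V → Set Ω) (Bad : Set Ω) (c : ℝ)
    (hAm : ∀ x, MeasurableSet (A x)) (hBm : MeasurableSet Bad) (hc : 0 ≤ c)
    (hcount : ∀ ω, ω ∉ Bad → ∀ F : Finset V, (∀ x ∈ F, ω ∈ A x) → (F.card : ℝ) ≤ c) :
    ∑ x, P.real (A x) ≤ c + Fintype.card V * P.real Bad := by
  classical
  have h1 : ∀ x, P.real (A x) = ∫ ω, (A x).indicator (1 : Ω → ℝ) ω ∂P := fun x =>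
    (integral_indicator_one (hAm x)).symm
  simp_rw [h1]
  have hint : ∀ x ∈ (Finset.univ : Finset V),
      Integrable (fun ω => (A x).indicator (1 : Ω → ℝ) ω) P :=
    fun x _ => (integrable_const (1 : ℝ)).indicator (hAm x)
  rw [← integral_finsetSum _ hint]
  have hpt : ∀ ω, (∑ x, (A x).indicator (1 : Ω → ℝ) ω) ≤
      c + Fintype.card V * Bad.indicator (1 : Ω → ℝ) ω := by
    intro ω
    have hsum : (∑ x, (A x).indicator (1 : Ω → ℝ) ω) =
        ((Finset.univ.filter (fun x => ω ∈ A x)).card : ℝ) := by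
      rw [Finset.natCast_card_filter]
      refine Finset.sum_congr rfl fun x _ => ?_
      by_cases hx : ω ∈ A x <;> simp [hx]
    rw [hsum]
    by_cases hω : ω ∈ Bad
    · have hle : ((Finset.univ.filter (fun x => ω ∈ A x)).card : ℝ) ≤ Fintype.card V := by
        exact_mod_cast (Finset.card_filter_le _ _).trans_eq Finset.card_univ
      simp only [Set.indicator_of_mem hω, Pi.one_apply, mul_one]
      linarith
    · simp only [Set.indicator_of_notMem hω, mul_zero, add_zero]
      exact hcount ω hω _ fun x hx => (Finset.mem_filter.1 hx).2
  have hintB1 : Integrable (fun ω => Bad.indicator (1 : Ω → ℝ) ω) P :=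
    (integrable_const (1 : ℝ)).indicator hBm
  have hintB : Integrable (fun ω => c + Fintype.card V * Bad.indicator (1 : Ω → ℝ) ω) P :=
    (integrable_const c).add (hintB1.const_mul _)
  calc ∫ ω, ∑ x, (A x).indicator (1 : Ω → ℝ) ω ∂P
      ≤ ∫ ω, (c + Fintype.card V * Bad.indicator (1 : Ω → ℝ) ω) ∂P :=
        integral_mono (integrable_finsetSum _ hint) hintB hpt
    _ = c + Fintype.card V * P.real Bad := by
        rw [integral_add (integrable_const c) (hintB1.const_mul _), integral_const_mul,
          integral_indicator_one hBm]
        simp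

/-- **Counting slice-filling vertices.** On the torus `T_n`, if a configuration has fewer than `K`
slice-filling clusters and no cluster with `≥ ε n³` vertices, then at most `K ε n³` vertices have
a slice-filling cluster (each such vertex lies in its own cluster, which is slice-filling).
[folklore] -/
theorem card_sliceFilling_vertices_le (n : ℕ) [NeZero n] (ω : BondConfig (TorusSite 3 n))
    (K : ℕ) (ε : ℝ)
    (hN : Set.ncard {S : Set (TorusSite 3 n) | (∃ x, S = openCluster ω x) ∧
      ∃ i : Fin 3, ∀ t : ZMod n, ∃ y ∈ S, y i = t} < K)
    (hG : ∀ x : TorusSite 3 n, ((openCluster ω x).ncard : ℝ) < ε * (n : ℝ) ^ 3)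
    (F : Finset (TorusSite 3 n))
    (hF : ∀ x ∈ F, ∃ i : Fin 3, ∀ t : ZMod n, ∃ y ∈ openCluster ω x, y i = t) :
    (F.card : ℝ) ≤ K * (ε * (n : ℝ) ^ 3) := by
  classical
  set 𝒮 : Finset (Set (TorusSite 3 n)) := F.image (openCluster ω) with h𝒮
  -- the clusters of slice-filling vertices are slice-filling clusters
  have hS_sub : (↑𝒮 : Set (Set (TorusSite 3 n))) ⊆ {S : Set (TorusSite 3 n) |
      (∃ x, S = openCluster ω x) ∧ ∃ i : Fin 3, ∀ t : ZMod n, ∃ y ∈ S, y i = t} := by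
    intro S hS
    rw [h𝒮, Finset.coe_image] at hS
    obtain ⟨x, hx, rfl⟩ := hS
    exact ⟨⟨x, rfl⟩, hF x (Finset.mem_coe.1 hx)⟩
  have hScard : 𝒮.card ≤ K := by
    refine le_trans ?_ hN.le
    rw [← Set.ncard_coe_finset]
    exact Set.ncard_le_ncard hS_sub (Set.toFinite _)
  -- every slice-filling vertex lies in its own (slice-filling) cluster
  have hF_sub : F ⊆ 𝒮.biUnion (fun S => (Set.toFinite S).toFinset) := by
    intro x hx
    rw [Finset.mem_biUnion]
    exact ⟨openCluster ω x, Finset.mem_image_of_mem _ hx,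
      (Set.Finite.mem_toFinset _).2 (mem_openCluster_self ω x)⟩
  have hFcard : (F.card : ℝ) ≤ ∑ S ∈ 𝒮, (((Set.toFinite S).toFinset.card : ℕ) : ℝ) := by
    have := (Finset.card_le_card hF_sub).trans Finset.card_biUnion_le
    exact_mod_cast this
  have hSbound : ∀ S ∈ 𝒮, (((Set.toFinite S).toFinset.card : ℕ) : ℝ) ≤ ε * (n : ℝ) ^ 3 := by
    intro S hS
    obtain ⟨x, -, rfl⟩ := Finset.mem_image.1 hS
    rw [← Set.ncard_eq_toFinset_card _ (Set.toFinite _)]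
    exact (hG x).le
  calc (F.card : ℝ) ≤ ∑ S ∈ 𝒮, (((Set.toFinite S).toFinset.card : ℕ) : ℝ) := hFcard
    _ ≤ ∑ S ∈ 𝒮, ε * (n : ℝ) ^ 3 := Finset.sum_le_sum hSbound
    _ = 𝒮.card * (ε * (n : ℝ) ^ 3) := by rw [Finset.sum_const, nsmul_eq_mul]
    _ ≤ K * (ε * (n : ℝ) ^ 3) := by
        -- the origin witnesses `0 ≤ |C(0)| < ε n³`
        have hε : 0 ≤ ε * (n : ℝ) ^ 3 := ((Nat.cast_nonneg _).trans_lt (hG 0)).le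
        exact mul_le_mul_of_nonneg_right (by exact_mod_cast hScard) hε

end PercTorusSliceFillingAssembly

open PercTorusSliceFillingAssembly in
/-- **Assembly of route PercTorusSliceFilling** (settles `stmt-CriticalPhenomena-5419`, exact
signature): `SliceFillingUpperBound → TorusNonProliferation → NoCriticalTorusGiant →
PercolationContinuityZ3`. For `δ > 0` and `n ≥ 3`: `θ(p_c) ≤ 2δ + P_{T_n,p_c}(some cluster has
≥ (δ/(M+1)) n³ vertices)`, by averaging `θ ≤ P(C(x) slice-filling)` over the `n³` vertices and
counting slice-filling vertices off the bad event; let `n → ∞`, then `δ ↓ 0`. [folklore] -/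
theorem percTorusSliceFilling_assembly_proof :
    Summit.CriticalPhenomena.PercolationContinuityZ3.Theses.PercTorusSliceFilling.Assembly := by
  unfold Summit.CriticalPhenomena.PercolationContinuityZ3.Theses.PercTorusSliceFilling.Assembly
  intro hA hT hG
  rw [_root_.PercolationContinuityZ3, percolationContinuityZ3_iff]
  set θ := theta (zdGraph 3) (0 : Site 3) (criticalProbI 3)
  have hθ0 : 0 ≤ θ := measureReal_nonneg
  suffices h : ∀ δ : ℝ, 0 < δ → θ ≤ 2 * δ by
    refine le_antisymm ?_ hθ0
    by_contra hlt
    push Not at hlt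
    have := h (θ / 4) (by positivity)
    linarith
  intro δ hδ
  obtain ⟨M, hM⟩ := hT δ hδ
  set K : ℕ := M + 1
  have hK0 : (0 : ℝ) < K := by positivity
  set ε : ℝ := δ / K with hε
  have hε0 : 0 < ε := div_pos hδ hK0
  -- for each `n ≥ 3`: `θ ≤ 2δ + P(ε-giant)`
  have key : ∀ n : ℕ, 3 ≤ n → θ ≤ 2 * δ +
      (bondPercolation (torusGraph 3 n) (criticalProbI 3)).real
        {ω | ∃ x : TorusSite 3 n, ε * (n : ℝ) ^ 3 ≤ ((openCluster ω x).ncard : ℝ)} := by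
    intro n hn
    haveI : NeZero n := ⟨by omega⟩
    set P := bondPercolation (torusGraph 3 n) (criticalProbI 3) with hP
    haveI : IsProbabilityMeasure P := by rw [hP]; infer_instance
    set A : TorusSite 3 n → Set (BondConfig (TorusSite 3 n)) := fun x =>
      {ω | ∃ i : Fin 3, ∀ t : ZMod n, ∃ y ∈ openCluster ω x, y i = t}
    set Nsf : BondConfig (TorusSite 3 n) → ℕ := fun ω => Set.ncard {S : Set (TorusSite 3 n) |
      (∃ x, S = openCluster ω x) ∧ ∃ i : Fin 3, ∀ t : ZMod n, ∃ y ∈ S, y i = t}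
    set Gi : Set (BondConfig (TorusSite 3 n)) :=
      {ω | ∃ x : TorusSite 3 n, ε * (n : ℝ) ^ 3 ≤ ((openCluster ω x).ncard : ℝ)} with hGidef
    set Bad : Set (BondConfig (TorusSite 3 n)) := {ω | K ≤ Nsf ω} ∪ Gi with hBad
    have hcard : Fintype.card (TorusSite 3 n) = n ^ 3 := by
      simp [ZMod.card, Finset.prod_const]
    have hn3 : (0 : ℝ) < (n : ℝ) ^ 3 := by positivity
    -- (1) `n³ θ ≤ Σ_x P(A x)` (SliceFillingUpperBound at every vertex)
    have h1 : (n : ℝ) ^ 3 * θ ≤ ∑ x : TorusSite 3 n, P.real (A x) := by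
      have hx : ∀ x ∈ (Finset.univ : Finset (TorusSite 3 n)), θ ≤ P.real (A x) :=
        fun x _ => hA _ n hn x
      calc (n : ℝ) ^ 3 * θ = ∑ _x : TorusSite 3 n, θ := by
            rw [Finset.sum_const, Finset.card_univ, hcard, nsmul_eq_mul]
            push_cast
            ring
        _ ≤ ∑ x : TorusSite 3 n, P.real (A x) := Finset.sum_le_sum hx
    -- (2) off `Bad`, at most `δ n³` slice-filling vertices
    have hcount : ∀ ω, ω ∉ Bad → ∀ F : Finset (TorusSite 3 n), (∀ x ∈ F, ω ∈ A x) →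
        (F.card : ℝ) ≤ δ * (n : ℝ) ^ 3 := by
      intro ω hω F hF
      simp only [hBad, Set.mem_union, Set.mem_setOf_eq, not_or, not_le, hGidef, not_exists]
        at hω
      obtain ⟨hN, hnoG⟩ := hω
      have h := card_sliceFilling_vertices_le n ω K ε hN hnoG F hF
      have hKε : (K : ℝ) * (ε * (n : ℝ) ^ 3) = δ * (n : ℝ) ^ 3 := by
        rw [hε]
        field_simp
      exact h.trans_eq hKε
    -- (3) double counting
    have h3 := sum_measureReal_le P A Bad (δ * (n : ℝ) ^ 3)
      (fun _ => MeasurableSet.of_discrete) MeasurableSet.of_discrete (by positivity) hcount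
    rw [hcard] at h3
    push_cast at h3
    -- (4) `P(Bad) ≤ δ + P(Gi)` (TorusNonProliferation)
    have h4 : P.real Bad ≤ δ + P.real Gi := by
      have hU : P.real Bad ≤ P.real {ω | K ≤ Nsf ω} + P.real Gi := measureReal_union_le _ _
      have hmono : P.real {ω | K ≤ Nsf ω} ≤ P.real {ω | M ≤ Nsf ω} :=
        measureReal_mono (μ := P) (fun ω (hω : K ≤ Nsf ω) => show M ≤ Nsf ω by omega)
      have hM' : P.real {ω | M ≤ Nsf ω} ≤ δ := hM n hn
      linarith
    -- combine
    have h5 : θ ≤ δ + P.real Bad := by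
      have h := h1.trans h3
      have h' : (n : ℝ) ^ 3 * θ ≤ (n : ℝ) ^ 3 * (δ + P.real Bad) := by linarith
      exact le_of_mul_le_mul_left h' hn3
    linarith
  -- let `n → ∞`
  have hlim := hG ε hε0
  have : θ - 2 * δ ≤ 0 := by
    refine ge_of_tendsto hlim ?_
    filter_upwards [eventually_ge_atTop 3] with n hn
    linarith [key n hn]
  linarith

end Summit.CriticalPhenomena.PercolationContinuityZ3.Theorems
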